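import Literature.NumberTheory.QuadraticForms.LocalNormIndex
import Literature.NumberTheory.QuadraticForms.HilbertSymbolNormCompatArchimedean
import Literature.NumberTheory.QuadraticFields.SquareRootGenerator
import HarnessLib

/-!
# A quadratic extension of a 𝔭-adic completion is a regular Hilbert field: the RELATIVE local norm index is `2`
# and the projection formula `(θ, y)_{K₀} = (θ, N_{K₀/F_v} y)_{F_v}` holds (O'Meara 63:13a, 63:19–63:20, for `[K₀ : F_v] = 2`)

Topic `NumberTheory/QuadraticForms`; namespace `Literature.NumberTheory.QuadraticForms`.  THEOREMS ONLY (no definition, no named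
fact, no instance, no notation, no `sorry`); no local class field theory (everything rests on the CFT-free ★ `LocalNormIndex`,
O'Meara 63:13a by counting square classes, and on ★ `HilbertSymbolNormCompatLowDegree`).  Cell `pub/hodgecm-mathlib`, F0∕P3a road
«D-N7-inert» (the unit fundamental lemma at an inert place, [Rogawski1990, Prop. 4.9.1 (b)]), brick (L4a) «local class set» TYPE (2):
for the torus `T_K × E¹` of [Rogawski1990, §3.6 p. 31] the Cartan algebra of `γ` at a non-split place `v` is `L′ × E_v` with `L′ = K E_v`
a QUADRATIC EXTENSION of `E_v`, and [Rogawski1990, Prop. 3.5.2 (a) p. 29] reads `H¹(F_v, T_K) ≅ K^× ∕ N_{L′∕K}(L′^×)` with `K = L′^{α′}`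
a quadratic extension of `F_v` DISTINCT from `E_v` — an abstract field of degree `2` over the completion `F_v`, not itself presented as a
completion.  This file supplies, for EVERY such field, the two facts the class-set count consumes.

THE MATHEMATICS.  `F` a number field, `v` a finite place (dyadic or not), `K₀` a field with `[K₀ : F_v] = 2`.  Then `K₀ = F_v(θ)` with
`θ² = c ∈ F_v^×` (★ `Quadratic.exists_sq_eq_algebraMap`, complete the square), `c = b d²` with `b ∈ F` GLOBAL (★
`exists_eq_algebraMap_mul_sq`: density of `F` in `F_v` and the Local Square Theorem), so `K₀ ≃ₐ F_v(√b) = QuadraticAlgebra F_v b 0`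
(§1, Mathlib `QuadraticAlgebra.lift`) `≃+* L_w` for the number field `L = F(√b)` and a place `w ∣ v` (★
`exists_ringEquiv_quadraticAlgebra_adicCompletion`).  Regularity of the Hilbert symbol (bilinear, non-degenerate on `K₀^×∕K₀^{×2}`) is
invariant under field isomorphisms (★ `IsRegularHilbertField.of_ringEquiv`) and holds for `L_w` (★ `isRegularHilbertField_adicCompletion`,
O'Meara 63:13∕63:13a), hence for `K₀` (§2 `isRegularHilbertField_of_finrank_adicCompletion_eq_two`).  Consequences (§3): the relative local norm index
`(K₀^× : N(K₀(√θ)^×)) = 2` for `θ ∉ K₀²` (★ `IsRegularHilbertField.index_quadraticNormSubgroup_eq_two`) and the projection formula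
`(θ, y)_{K₀} = (θ, N_{K₀∕F_v} y)_{F_v}` for `θ ∈ F_v^×` (★ `IsRegularHilbertField.hilbertSymbol_eq_hilbertSymbol_norm`, quadratic degree),
i.e. «`y` is a norm from `K₀(√θ)` iff `N_{K₀∕F_v} y` is a norm from `F_v(√θ)`» (`comap_norm_quadraticNormSubgroup_eq_of_…`) — the
norm functoriality of [Rogawski1990, Prop. 3.5.2 (a)] ∕ [Omeara1963, 63:19–63:20] in the quadratic case.
HC_CM is proved only modulo the printed citations until rung 0 closes; this file is unconditional local algebra.

Dedup: `rg -n "theorem isRegularHilbertField" Literature` → `adicCompletion`, `ℚ_[p]`, `ℝ`, `IsAlgClosed`, `completion_infinitePlace` only;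
no statement for a finite extension of a completion given as an abstract field (transport ★ `IsRegularHilbertField.of_ringEquiv` reused).

## References
* [Omeara1963] O. T. O'Meara, *Introduction to quadratic forms*, Grundlehren 117 (1963), §63B (63:10, 63:13, 63:13a), §63C (63:19, 63:20).
* [Serre1973] J.-P. Serre, *A Course in Arithmetic*, GTM 7 (1973), Ch. III §1.2 Thm 2.
* [Lang2002] S. Lang, *Algebra*, 3rd ed., GTM 211 (2002), Ch. VI §6 Thm. 6.2 (cyclic extensions of degree `n` with `μ_n ⊆ F` are `F(α)`, `αⁿ ∈ F`).
* [Rogawski1990] J. D. Rogawski, *Automorphic Representations of Unitary Groups in Three Variables*, Ann. of Math. Stud. 123 (1990),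
  §3.5 Prop. 3.5.2 (a) p. 29, §3.6 p. 31 (type (2) tori `T_K × E¹`).
-/

set_option autoImplicit false

noncomputable section

open NumberField IsDedekindDomain

namespace Literature.NumberTheory.QuadraticForms

/-! ## §1 A quadratic extension with a square-root generator is `QuadraticAlgebra F c 0` -/

section SquareRoot

variable {F K : Type*} [Field F] [Field K] [Algebra F K]

/-- **`K = F(√c)` as an algebra isomorphism.**  If `[K : F] = 2`, `θ ∈ K ∖ F` and `θ² = c ∈ F`, the substitution `ω ↦ θ`
(Mathlib `QuadraticAlgebra.lift`) is an `F`-algebra isomorphism `QuadraticAlgebra F c 0 ≃ₐ[F] K`: it is onto because `K = F ⊕ F θ`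
(★ `Quadratic.exists_eq_add_mul`), hence bijective by dimension count (`2 = 2`).  (Lang, *Algebra*, Ch. VI §6 Thm. 6.2 with `n = 2`:
a cyclic extension of degree `2` in characteristic `≠ 2` is `F(√c) = F[X]∕(X² − c)`.) [cite: Lang2002, Ch. VI §6 Thm. 6.2] -/
theorem exists_algEquiv_quadraticAlgebra_of_sq_eq (h2 : Module.finrank F K = 2) {θ : K} {c : F}
    (hθ : θ ∉ Set.range (algebraMap F K)) (hc : θ ^ 2 = algebraMap F K c) :
    ∃ e : QuadraticAlgebra F c 0 ≃ₐ[F] K, e QuadraticAlgebra.omega = θ := by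
  have hu : θ * θ = c • (1 : K) + (0 : F) • θ := by
    rw [← pow_two, hc, Algebra.algebraMap_eq_smul_one, zero_smul, add_zero]
  set f : QuadraticAlgebra F c 0 →ₐ[F] K := QuadraticAlgebra.lift ⟨θ, hu⟩ with hf
  have hfapply : ∀ z : QuadraticAlgebra F c 0, f z = z.re • (1 : K) + z.im • θ := fun z => rfl
  have hfω : f QuadraticAlgebra.omega = θ := by
    rw [hfapply, QuadraticAlgebra.omega_re, QuadraticAlgebra.omega_im, zero_smul, one_smul, zero_add]
  have hsurj : Function.Surjective f := by
    intro x
    obtain ⟨a, b, rfl⟩ := Literature.NumberTheory.QuadraticFields.Quadratic.exists_eq_add_mul h2 hθ x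
    exact ⟨⟨a, b⟩, by rw [hfapply, Algebra.smul_def, mul_one, Algebra.smul_def]⟩
  haveI : FiniteDimensional F K := Module.finite_of_finrank_eq_succ h2
  have hinj : Function.Injective f := by
    have hdim : Module.finrank F (QuadraticAlgebra F c 0) = Module.finrank F K := by
      rw [QuadraticAlgebra.finrank_eq_two, h2]
    exact (LinearMap.injective_iff_surjective_of_finrank_eq_finrank hdim (f := f.toLinearMap)).mpr hsurj
  exact ⟨AlgEquiv.ofBijective f ⟨hinj, hsurj⟩, hfω⟩

/-- If `θ ∉ F` and `θ² = c ∈ F`, then `c` is not a square in `F` (else `θ = ± √c ∈ F`). [folklore] -/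
private theorem not_isSquare_of_sq_eq_of_not_mem_range {θ : K} {c : F}
    (hθ : θ ∉ Set.range (algebraMap F K)) (hc : θ ^ 2 = algebraMap F K c) : ¬ IsSquare c := by
  rintro ⟨s, hs⟩
  have hprod : (θ - algebraMap F K s) * (θ + algebraMap F K s) = 0 := by
    have h' : θ ^ 2 = algebraMap F K s * algebraMap F K s := by rw [← map_mul, ← hs, hc]
    linear_combination h'
  rcases mul_eq_zero.mp hprod with h | h
  · exact hθ ⟨s, (sub_eq_zero.mp h).symm⟩
  · exact hθ ⟨-s, by rw [map_neg]; exact (eq_neg_of_add_eq_zero_left h).symm⟩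

end SquareRoot

/-! ## §2 Quadratic extensions of a 𝔭-adic completion are regular Hilbert fields -/

section Completion

open Literature.NumberTheory.QuadraticFields

variable (F : Type) [Field F] [NumberField F] (v : HeightOneSpectrum (𝓞 F))
variable {K₀ : Type*} [Field K₀] [Algebra (v.adicCompletion F) K₀]

/-- **A quadratic extension `K₀` of `F_v` is isomorphic to a completion `L_w` of a quadratic number field `L = F(√b)`.**
`K₀ = F_v(θ)`, `θ² = c` (★ `Quadratic.exists_sq_eq_algebraMap`), `c = b d²` with `b ∈ F`, `v(b) ≤ 1` (★ `exists_eq_algebraMap_mul_sq`),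
`K₀ ≃ₐ QuadraticAlgebra F_v b 0` (§1 with the generator `θ∕d`) `≃+* L_w` (★ `exists_ringEquiv_quadraticAlgebra_adicCompletion`) for any place
`w` of `L = QuadraticAlgebra F b 0` over `v`.  Stated as: some number-field completion is ring-isomorphic to `K₀` compatibly with `F_v`.
[cite: Omeara1963, §63B Cor. 63:13a] -/
theorem exists_ringEquiv_adicCompletion_of_finrank_eq_two (hK₀ : Module.finrank (v.adicCompletion F) K₀ = 2) :
    ∃ (b : F) (hb : ¬ IsSquare b),
      haveI := Literature.NumberTheory.Automorphic.fact_sq_ne_of_not_isSquare F b hb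
      haveI := Literature.NumberTheory.Automorphic.QuadraticAlgebra.numberField F b
      ∃ (w : HeightOneSpectrum (𝓞 (QuadraticAlgebra F b 0))) (_ : w.asIdeal.LiesOver v.asIdeal)
        (e : K₀ ≃+* w.adicCompletion (QuadraticAlgebra F b 0)),
        ∀ x : F, e (algebraMap (v.adicCompletion F) K₀ (algebraMap F (v.adicCompletion F) x)) =
          algebraMap (QuadraticAlgebra F b 0) (w.adicCompletion (QuadraticAlgebra F b 0))
            (algebraMap F (QuadraticAlgebra F b 0) x) := by
  haveI : CharZero (v.adicCompletion F) := charZero_of_injective_algebraMap (algebraMap F _).injective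
  haveI : NeZero (2 : v.adicCompletion F) := ⟨two_ne_zero⟩
  -- a square-root generator `θ`, `θ² = c`
  obtain ⟨θ, c, hθ, hθc⟩ := Quadratic.exists_sq_eq_algebraMap (F := v.adicCompletion F) (K := K₀) hK₀
  have hc0 : c ≠ 0 := Quadratic.sq_ne_zero_of_not_mem_range hθ hθc
  -- a global integral representative `b` of the square class of `c`
  obtain ⟨b, d, hd0, -, hcb⟩ := exists_eq_algebraMap_mul_sq F v c hc0
  -- the rescaled generator `θ' = θ / d`, `θ'² = b`
  set θ' : K₀ := θ * (algebraMap (v.adicCompletion F) K₀ d)⁻¹ with hθ'def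
  have hd0' : algebraMap (v.adicCompletion F) K₀ d ≠ 0 := (map_ne_zero _).mpr hd0
  have hθ' : θ' ∉ Set.range (algebraMap (v.adicCompletion F) K₀) := by
    rintro ⟨q, hq⟩
    exact hθ ⟨q * d, by rw [map_mul, hq, hθ'def, inv_mul_cancel_right₀ hd0']⟩
  have hθ'sq : θ' ^ 2 = algebraMap (v.adicCompletion F) K₀ (algebraMap F (v.adicCompletion F) b) := by
    have hd2 : algebraMap F (v.adicCompletion F) b = c * (d ^ 2)⁻¹ := by
      rw [hcb, mul_inv_cancel_right₀ (pow_ne_zero 2 hd0)]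
    rw [hθ'def, mul_pow, hθc, hd2, map_mul, map_inv₀, map_pow, inv_pow]
  -- `b` is a non-square in `F_v`, hence in `F`
  have hbv : ¬ IsSquare (algebraMap F (v.adicCompletion F) b) := not_isSquare_of_sq_eq_of_not_mem_range hθ' hθ'sq
  have hbF : ¬ IsSquare b := fun ⟨s, hs⟩ => hbv ⟨algebraMap F _ s, by rw [hs, map_mul]⟩
  haveI hfv := Literature.NumberTheory.Automorphic.fact_sq_ne_of_not_isSquare (v.adicCompletion F) _ hbv
  haveI hfF := Literature.NumberTheory.Automorphic.fact_sq_ne_of_not_isSquare F b hbF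
  haveI := Literature.NumberTheory.Automorphic.QuadraticAlgebra.numberField F b
  refine ⟨b, hbF, ?_⟩
  set L := QuadraticAlgebra F b 0 with hL
  -- a place `w` of `L` over `v`
  obtain ⟨Q, hQmax, hQover⟩ := Ideal.exists_maximal_ideal_liesOver_of_isIntegral (S := 𝓞 L) v.asIdeal
  have hQ0 : Q ≠ ⊥ := by
    intro h0
    apply v.ne_bot
    rw [hQover.over, h0, Ideal.under_bot]
  let w : HeightOneSpectrum (𝓞 L) := ⟨Q, hQmax.isPrime, hQ0⟩
  haveI : w.asIdeal.LiesOver v.asIdeal := hQover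
  -- the completion map `F_v → L_w` and the local isomorphism `F_v(√b) ≃ L_w`
  obtain ⟨f, hf, hfK⟩ := exists_continuous_ringHom_adicCompletion F L v w
  have hfin : Module.finrank F L = 2 := QuadraticAlgebra.finrank_eq_two b 0
  have hω : (QuadraticAlgebra.omega : L) * QuadraticAlgebra.omega = algebraMap F L b :=
    Literature.NumberTheory.Automorphic.QuadraticAlgebra.omega_mul_omega_eq_algebraMap F b
  obtain ⟨e, he, -⟩ := exists_ringEquiv_quadraticAlgebra_adicCompletion F L v w hf hfK hfin hω
  -- `K₀ ≃ₐ F_v(√b)`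
  obtain ⟨e₁, -⟩ := exists_algEquiv_quadraticAlgebra_of_sq_eq hK₀ hθ' hθ'sq
  refine ⟨w, hQover, e₁.symm.toRingEquiv.trans e, fun x => ?_⟩
  rw [RingEquiv.trans_apply, AlgEquiv.coe_ringEquiv, AlgEquiv.commutes, he, hfK]

/-- **A quadratic extension of a 𝔭-adic completion is a regular Hilbert field**: for `F` a number field, `v` a finite place (dyadic
included) and `K₀` a field with `[K₀ : F_v] = 2`, the Hilbert symbol of `K₀` is bilinear and non-degenerate on `K₀^×∕K₀^{×2}` — transport
of ★ `isRegularHilbertField_adicCompletion` (O'Meara 63:13, 63:13a at `L_w`) along `K₀ ≃+* L_w`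
(`exists_ringEquiv_adicCompletion_of_finrank_eq_two`, ★ `IsRegularHilbertField.of_ringEquiv`).  [cite: Omeara1963, §63B Prop. 63:13, Cor. 63:13a] [cite: Serre1973, Ch. III §1.2 Thm 2] -/
theorem isRegularHilbertField_of_finrank_adicCompletion_eq_two (hK₀ : Module.finrank (v.adicCompletion F) K₀ = 2) :
    IsRegularHilbertField K₀ := by
  obtain ⟨b, hb, h⟩ := exists_ringEquiv_adicCompletion_of_finrank_eq_two F v hK₀
  haveI := Literature.NumberTheory.Automorphic.fact_sq_ne_of_not_isSquare F b hb
  haveI := Literature.NumberTheory.Automorphic.QuadraticAlgebra.numberField F b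
  obtain ⟨w, -, e, -⟩ := h
  exact (isRegularHilbertField_adicCompletion (QuadraticAlgebra F b 0) w).of_ringEquiv e.symm

/-! ## §3 Consequences: the relative local norm index and the projection formula -/

/-- **The relative local norm index is `2`.**  For a quadratic extension `K₀` of `F_v` and a non-square `θ ∈ K₀^×`:
`(K₀^× : N(K₀(√θ)^×)) = 2`, where `N(K₀(√θ)^×) = quadraticNormSubgroup K₀ θ = {x² − θ y²}` (O'Meara 63:13a for the local field `K₀`,
which is not itself a completion of `F`). [cite: Omeara1963, §63B Cor. 63:13a] -/
theorem index_quadraticNormSubgroup_eq_two_of_finrank_adicCompletion_eq_two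
    (hK₀ : Module.finrank (v.adicCompletion F) K₀ = 2) {θ : K₀} (hθ0 : θ ≠ 0) (hθ : ¬ IsSquare θ) :
    (quadraticNormSubgroup K₀ θ).index = 2 :=
  (isRegularHilbertField_of_finrank_adicCompletion_eq_two F v hK₀).index_quadraticNormSubgroup_eq_two hθ0 hθ

/-- `2 ≠ 0` in a quadratic extension of `F_v`. [folklore] -/
private theorem two_ne_zero_of_finrank_adicCompletion_eq_two (hK₀ : Module.finrank (v.adicCompletion F) K₀ = 2) : (2 : K₀) ≠ 0 :=
  (isRegularHilbertField_of_finrank_adicCompletion_eq_two F v hK₀).two_ne_zero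

/-- **The projection formula in quadratic degree over a completion.**  For a quadratic extension `K₀` of `F_v`, `θ ∈ F_v^×` and
`y ∈ K₀^×`: `(θ, y)_{K₀} = (θ, N_{K₀∕F_v} y)_{F_v}` — ★ `IsRegularHilbertField.hilbertSymbol_eq_hilbertSymbol_norm` for the two regular
fields `F_v` (★ `isRegularHilbertField_adicCompletion`) and `K₀` (§2).  [cite: Omeara1963, §63C (63:19), (63:20)] [cite: Serre1973, Ch. III §1.2 Thm 2] -/
theorem hilbertSymbol_eq_hilbertSymbol_norm_of_finrank_adicCompletion_eq_two
    (hK₀ : Module.finrank (v.adicCompletion F) K₀ = 2) {θ : v.adicCompletion F} (hθ : θ ≠ 0) {y : K₀} (hy : y ≠ 0) :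
    hilbertSymbol K₀ (algebraMap (v.adicCompletion F) K₀ θ) y =
      hilbertSymbol (v.adicCompletion F) θ (Algebra.norm (v.adicCompletion F) y) := by
  haveI : FiniteDimensional (v.adicCompletion F) K₀ := Module.finite_of_finrank_eq_succ hK₀
  exact (isRegularHilbertField_adicCompletion F v).hilbertSymbol_eq_hilbertSymbol_norm
    (isRegularHilbertField_of_finrank_adicCompletion_eq_two F v hK₀) (Or.inr hK₀) hθ hy

/-- **Norm functoriality of the relative norm groups** ([Rogawski1990, Prop. 3.5.2 (a)] in the quadratic case; O'Meara 63:20): for a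
quadratic extension `K₀` of `F_v`, `θ ∈ F_v^×` and `y ∈ K₀^×`, `y` is a norm from `K₀(√θ)` iff `N_{K₀∕F_v} y` is a norm from `F_v(√θ)`.
[cite: Omeara1963, §63C (63:20)] [cite: Rogawski1990, §3.5 Prop. 3.5.2 (a) p. 29] -/
theorem mem_quadraticNormSubgroup_iff_norm_mem_of_finrank_adicCompletion_eq_two
    (hK₀ : Module.finrank (v.adicCompletion F) K₀ = 2) {θ : v.adicCompletion F} (hθ : θ ≠ 0) (y : K₀ˣ) :
    y ∈ quadraticNormSubgroup K₀ (algebraMap (v.adicCompletion F) K₀ θ) ↔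
      Units.map (Algebra.norm (v.adicCompletion F) : K₀ →* v.adicCompletion F) y ∈
        quadraticNormSubgroup (v.adicCompletion F) θ := by
  haveI : NeZero (2 : K₀) := ⟨two_ne_zero_of_finrank_adicCompletion_eq_two F v hK₀⟩
  haveI : NeZero (2 : v.adicCompletion F) := neZero_two_adicCompletion F v
  have hθ' : algebraMap (v.adicCompletion F) K₀ θ ≠ 0 := (map_ne_zero _).mpr hθ
  rw [← hilbertSymbol_eq_one_iff_mem_quadraticNormSubgroup hθ', ← hilbertSymbol_eq_one_iff_mem_quadraticNormSubgroup hθ,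
    Units.coe_map, hilbertSymbol_comm (y : K₀),
    hilbertSymbol_eq_hilbertSymbol_norm_of_finrank_adicCompletion_eq_two F v hK₀ hθ y.ne_zero, hilbertSymbol_comm θ]

/-- The same as an equality of subgroups of `K₀^×`: the preimage of `N(F_v(√θ)^×)` under the norm `N_{K₀∕F_v}` is `N(K₀(√θ)^×)`.
[cite: Omeara1963, §63C (63:20)] -/
theorem comap_norm_quadraticNormSubgroup_eq_of_finrank_adicCompletion_eq_two
    (hK₀ : Module.finrank (v.adicCompletion F) K₀ = 2) {θ : v.adicCompletion F} (hθ : θ ≠ 0) :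
    (quadraticNormSubgroup (v.adicCompletion F) θ).comap
        (Units.map (Algebra.norm (v.adicCompletion F) : K₀ →* v.adicCompletion F)) =
      quadraticNormSubgroup K₀ (algebraMap (v.adicCompletion F) K₀ θ) := by
  ext y
  rw [Subgroup.mem_comap, mem_quadraticNormSubgroup_iff_norm_mem_of_finrank_adicCompletion_eq_two F v hK₀ hθ]

/-- **Both relative norm groups have index `2` and correspond under the norm**: for a quadratic extension `K₀` of `F_v` and `θ ∈ F_v^×`
not a square in `K₀`, the norm `N_{K₀∕F_v}` induces a bijection `K₀^× ∕ N(K₀(√θ)^×) ≃ F_v^× ∕ N(F_v(√θ)^×)` of two groups of order `2`;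
here: the element-free form «`y ∉ N(K₀(√θ)^×)` iff `N y ∉ N(F_v(√θ)^×)`» together with the two index statements.
[cite: Omeara1963, §63B Cor. 63:13a; §63C (63:20)] -/
theorem index_eq_two_and_index_eq_two_of_finrank_adicCompletion_eq_two
    (hK₀ : Module.finrank (v.adicCompletion F) K₀ = 2) {θ : v.adicCompletion F} (hθ0 : θ ≠ 0)
    (hθ : ¬ IsSquare (algebraMap (v.adicCompletion F) K₀ θ)) :
    (quadraticNormSubgroup K₀ (algebraMap (v.adicCompletion F) K₀ θ)).index = 2 ∧
      (quadraticNormSubgroup (v.adicCompletion F) θ).index = 2 := by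
  refine ⟨index_quadraticNormSubgroup_eq_two_of_finrank_adicCompletion_eq_two F v hK₀ ((map_ne_zero _).mpr hθ0) hθ,
    index_quadraticNormSubgroup_adicCompletion_eq_two F v hθ0 fun ⟨s, hs⟩ => hθ ⟨algebraMap _ K₀ s, ?_⟩⟩
  rw [hs, map_mul]

end Completion

end Literature.NumberTheory.QuadraticForms
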